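import Literature.Geometry.Lorentzian.MassCapacityPotential
import Literature.Geometry.Lorentzian.HarmonicallyFlatPotential
import HarnessLib

/-!
# Bray's (87) for the capacity potential on a harmonically flat end:
# `φ = 1 − ℰ(Σ, g)/(2|x|) + O₁(|x|⁻²)`

Assembly of `MassCapacityPotential.lean` (the capacity `ℰ(Σ, g)` of Def. 17 is `2c` for the
harmonic potential `φ₀` with expansion `φ₀ ∘ Φ = 1 − c/r + O₁(r⁻²)`; no sign hypothesis) and
`HarmonicallyFlatPotential.lean` (on a harmonically flat end every `h`-harmonic function with a
limit has such an expansion) into the literal statement of Bray, J. Differential Geom. 59 (2001),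
§6, (87): *"Define the Green's function to be the function `φ` which satisfies (86) … Then we
also see that `φ(x) = 1 − ℰ/(2|x|) + O(1/|x|²)`"* — for ends that are harmonically flat at
infinity (Bray's standing Assumption of §3; in §6 he writes "the total mass of a manifold that is
harmonically flat at infinity"), with, in addition, the gradient estimate
`D(φ ∘ Φ − (1 − ℰ/(2r))) = O(r⁻³)`:

* `AFEnd.IsHarmonicallyFlatWith.capacity_potential_expansion` — for an exterior region `U` of a
  harmonically flat, asymptotically flat end and a test function `φ₀` of the capacity which is
  `h`-harmonic on `U` with `∫_U |∇φ₀|² < ∞`: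
  `φ₀ ∘ Φ − (1 − ℰ(Σ,g)/(2r)) = O(r⁻²)` and `‖D(φ₀ ∘ Φ − (1 − ℰ(Σ,g)/(2r)))‖ = O(r⁻³)`, where
  `ℰ(Σ, g) = (horizonCapacity D.h e U).toReal`;
* `IsOutsideOf.capacity_potential_expansion` — the same under the hypotheses of the named fact
  `Bray2001_mass_ge_half_capacity` (order-`1` asymptotic flatness, `Σ ∈ 𝒮` with outside `U`).

So, on harmonically flat ends, Thm. 9 (`m ≥ ½ ℰ(Σ, g)`) is the statement `m ≥ c` for the
monopole coefficient `c` of the Green's function, the form in which Bray derives it from Thm. 8.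
Everything is proved; there are no definitions and no named facts.

## References

* H. L. Bray, *Proof of the Riemannian Penrose inequality using the positive mass theorem*,
  J. Differential Geom. 59 (2001) 177–267 (arXiv:math/9911173), §6, Def. 17, (86)–(87), Thm. 9;
  §2 Def. 1; §3 (Assumption) (key `BrayRPI2001`).
-/

noncomputable section

open Set Function Filter Metric Bornology Asymptotics Topology MeasureTheory Manifold Bundle
  TopologicalSpace
open scoped Real ContDiff Manifold ENNReal

namespace Literature.Geometry.Lorentzian

variable {X : Type} [TopologicalSpace X] [ChartedSpace E3 X] [IsManifold (𝓡 3) ∞ X]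
  [T2Space X] [LocallyCompactSpace X] [SigmaCompactSpace X] [MeasurableSpace X] [BorelSpace X]
  {e : AFEnd X} {U : Opens X} (D : InitialDataSet (𝓡 3) X) [D.metric.HasLeviCivita]

/-- **Bray's (87) on a harmonically flat end: `φ₀ = 1 − ℰ(Σ, g)/(2|x|) + O₁(|x|⁻²)`.** Let the
end `e` be harmonically flat beyond `R₁` (Bray's §2 Def. 1) and asymptotically flat of some
order `α > 0` in the metric, `U` an exterior region of `e`, and `φ₀` a test function of the
capacity of `Σ = ∂U` (continuous, smooth on `U`, `0` on `Σ` and inside, `→ 1`) which is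
`h`-harmonic on `U` with `∫_U |∇φ₀|² < ∞`. Then, with `ℰ = (horizonCapacity D.h e U).toReal`,
`φ₀ ∘ Φ − (1 − ℰ/(2r)) = O(r⁻²)` and `‖D(φ₀ ∘ Φ − (1 − ℰ/(2r)))‖ = O(r⁻³)` in the chart of the end
(`exists_expansion_fderiv_of_dalembertian_eq_zero` gives an expansion `1 − c/r + O₁(r⁻²)`, and
`horizonCapacity_toReal_div_two_eq_of_harmonic_of_expansion'` identifies `c = ℰ/2`).
[cite: BrayRPI2001, §6 (86)–(87) with Def. 17] -/
theorem AFEnd.IsHarmonicallyFlatWith.capacity_potential_expansion {R₁ : ℝ} {𝒰 : E3 → ℝ}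
    (hHF : e.IsHarmonicallyFlatWith D R₁ 𝒰) {α : ℝ} (hα : 0 < α)
    (hAF : e.IsMetricAsymptoticallyFlat D α) (hU : IsExteriorRegion e U) {φ₀ : X → ℝ}
    (hφ₀ : IsCapacityTestFn e U φ₀)
    (hΔ : ∀ x ∈ (U : Set X), D.metric.dalembertian φ₀ x = 0)
    (hfin : ∫⁻ x in (U : Set X), ENNReal.ofReal (gradNorm D.h φ₀ x ^ 2) ∂riemannianMeasure D.h < ⊤) :
    (fun x : E3 ↦ endValue e φ₀ x - (1 - (horizonCapacity D.h e U).toReal / 2 / ‖x‖))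
        =O[cobounded E3] (fun x ↦ ‖x‖ ^ (-2 : ℝ)) ∧
      (fun x : E3 ↦ ‖fderiv ℝ (fun y ↦ endValue e φ₀ y -
          (1 - (horizonCapacity D.h e U).toReal / 2 / ‖y‖)) x‖)
        =O[cobounded E3] fun x ↦ ‖x‖ ^ (-3 : ℝ) := by
  obtain ⟨-, R', -, hfarU, -⟩ := id hU
  -- `φ₀` is smooth and harmonic at the chart points beyond `R'`
  have hmem : ∀ y : exteriorRegion e.R, R' < ‖(y : E3)‖ → e.dataChart y ∈ (U : Set X) :=
    fun y hy ↦ hfarU (e.mem_far_iff.2 ⟨y, hy, rfl⟩)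
  have hφ : ∀ y : exteriorRegion e.R, R' < ‖(y : E3)‖ →
      ContMDiffAt (𝓡 3) 𝓘(ℝ, ℝ) 2 φ₀ (e.dataChart y) := fun y hy ↦
    (hφ₀.contMDiffOn.of_le (WithTop.coe_le_coe.mpr le_top)).contMDiffAt
      (U.isOpen.mem_nhds (hmem y hy))
  have hΔ' : ∀ y : exteriorRegion e.R, R' < ‖(y : E3)‖ →
      D.metric.dalembertian φ₀ (e.dataChart y) = 0 := fun y hy ↦ hΔ _ (hmem y hy)
  obtain ⟨c, h0, h1⟩ := hHF.exists_expansion_fderiv_of_dalembertian_eq_zero hφ hΔ'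
    hφ₀.tendstoAtEnd
  obtain ⟨hc, -⟩ := horizonCapacity_toReal_div_two_eq_of_harmonic_of_expansion' D hα hAF hU hφ₀
    hΔ hfin h1
  rw [hc]
  exact ⟨h0, h1⟩

/-- **Bray's (87) under the hypotheses of `Bray2001_mass_ge_half_capacity`, on a harmonically
flat end**: for time-symmetric data whose chosen end `e` is asymptotically flat of order `1` and
harmonically flat at infinity, a horizon `Σ ∈ 𝒮` with outside region `U` (`IsOutsideOf`), and the
capacity potential `φ₀` of `Σ` (a test function, `h`-harmonic on `U`, of finite energy over `U`;
it is unique and satisfies `0 < φ₀ < 1` automatically, `MassCapacityPotential.lean`):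
`φ₀ ∘ Φ = 1 − ℰ(Σ,g)/(2r) + O(r⁻²)` with `‖D(φ₀ ∘ Φ − (1 − ℰ(Σ,g)/(2r)))‖ = O(r⁻³)`,
`ℰ(Σ, g) = (horizonCapacity D.h e U).toReal` — the left-hand side `½ ℰ(Σ, g)` of Thm. 9 is the
monopole coefficient of the Green's function. [cite: BrayRPI2001, §6 (87) and Thm. 9] -/
theorem IsOutsideOf.capacity_potential_expansion {R₁ : ℝ} {𝒰 : E3 → ℝ}
    (hHF : e.IsHarmonicallyFlatWith D R₁ 𝒰) {S' : Type*} {f' : S' → X}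
    {ν' : NormalField (𝓡 3) f'} (hAF : e.IsAsymptoticallyFlat D 1) (hU : IsOutsideOf e U f' ν')
    {φ₀ : X → ℝ} (hφ₀ : IsCapacityTestFn e U φ₀)
    (hΔ : ∀ x ∈ (U : Set X), D.metric.dalembertian φ₀ x = 0)
    (hfin : ∫⁻ x in (U : Set X), ENNReal.ofReal (gradNorm D.h φ₀ x ^ 2) ∂riemannianMeasure D.h < ⊤) :
    (fun x : E3 ↦ endValue e φ₀ x - (1 - (horizonCapacity D.h e U).toReal / 2 / ‖x‖))
        =O[cobounded E3] (fun x ↦ ‖x‖ ^ (-2 : ℝ)) ∧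
      (fun x : E3 ↦ ‖fderiv ℝ (fun y ↦ endValue e φ₀ y -
          (1 - (horizonCapacity D.h e U).toReal / 2 / ‖y‖)) x‖)
        =O[cobounded E3] fun x ↦ ‖x‖ ^ (-3 : ℝ) :=
  hHF.capacity_potential_expansion D one_pos hAF.isMetricAsymptoticallyFlat hU.isExteriorRegion
    hφ₀ hΔ hfin

end Literature.Geometry.Lorentzian

end
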